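import Summits.CriticalPhenomena.PercolationContinuityZ3.Theorems.PercNearOneGluingNoHeavyLowerTailHullPortTASections
import Summits.CriticalPhenomena.PercolationContinuityZ3.Theorems.PercNearOneGluingNoHeavyLowerTailHullPortTAStep
import Summits.CriticalPhenomena.PercolationContinuityZ3.Theorems.PercNearOneGluingNoHeavyLowerTailHullPortTACond
import Summits.CriticalPhenomena.PercolationContinuityZ3.Theorems.PercNearOneGluingNoHeavyLowerTailHullPortTASDefs
import HarnessLib

/-!
# `NoHeavyLowerTail` (stmt-CriticalPhenomena-4575) — owner-set `T_A`: sections, Lemma 2, step (II)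

Support file (prover `prim-hp-7`; `--supports stmt-CriticalPhenomena-4575`); no definitions, named facts or sorries.
prim-hp-8's proof of `(S5)_r` for every `r` (cell memo PROOF-S5-ALL-R.md ⟹ GEN for every relay set ⟹ Kozma–Nitzan's
Conjecture 1 for all `|A|` ⟹ crux stmt-4576 `AdditiveGluing`) needs the inequality (Htw) = the diagonal of its (K9):
`Σ_W μ(C_Y = W)(p_W − p) H_{G−W}(v) ≥ 0` with `H_{G−W}(v) = Cov_{G−W}(g(C_x), 1{v ↔ S})` for an owner SET `S ∋ x`.
prim-hp-7's route (cell memo HP7-HTW-PROOF.md): this is the `T_A` induction of `…HullPortTA*` (prim-ineq-prove-5,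
HP7-MDLX-PROOF §0–§5) with the event `{s ↔ y}` replaced by `{v ↔ S}` and Lemma `P_v` replaced by prim-hp-8's
within-bound (★^H) AT SINGLETONS.  This file: the one-edge sections of `taBS, taAS, tabS, taaS` (instances of the tree's
`section_generic` / `avoid_conn_section`), Lemma 2^S (vdBHK Thm 1.3 with the avoidance set `S ∪ X`), the reading of the
functionals in the deleted configuration, and step (II) `taBS_insert_le` from the hypothesis `hStarH` ((★^H) at a
singleton source, in `delE` form).
[cite: VandenbergHaggstromKahn2005, Thm. 1.3 (p. 6), §2.1 Lemma 2.4 (p. 10) — corollaries; §1 pp. 3–5 (induced model on `G − Z`)]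
-/

noncomputable section

namespace Summit.CriticalPhenomena.PercolationContinuityZ3.Theorems

open MeasureTheory Set Literature.Probability.LatticeModels Literature.Probability.Percolation
open scoped Classical

variable {V : Type*}

namespace HullPort

open LonePortSum LonePortSumGeneral BHK2006 DecisionTree KNPreFKG KNSep

section TAS

variable [Fintype V]

/-! ### One-edge sections -/




/-- **Section identity for `B` (owner set)**: `B_X(w) = (1 − w e) B_X(w₀) + (w e) B_{X∪{v′}}(w₀)`, `e = {x₀, v′}`, `x₀ ∈ X`.
(cell memo prim-hp-7 HP7-HTW-PROOF.md §3, in set form) [folklore] -/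
theorem taBS_section (w w₀ : Sym2 V → ℝ) (x : V) (S : Set V) (v x₀ v' : V) (X : Set V) (hx₀ : x₀ ∈ X)
    (he0 : w₀ s(x₀, v') = 0) (hoff : ∀ f, f ≠ s(x₀, v') → w₀ f = w f) (g : Set (Sym2 V) → ℝ) :
    taBS w x S v X g = (1 - w s(x₀, v')) * taBS w₀ x S v X g + w s(x₀, v') * taBS w₀ x S v (insert v' X) g := by
  have key := section_generic w w₀ x x₀ v' X hx₀ he0 hoff
    (fun w' B => delE w' B (fun η => g (openEdgeCluster η x) * ind (connS S v) η) -
      delE w' B (fun η => g (openEdgeCluster η x)) * delE w' B (ind (connS S v)))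
    (fun w w' B h => by simp only [delE_congr_of_mem h])
  simpa only [taBS, taCS] using key

/-- **Section identity for `A` (owner set)**. (cell memo prim-hp-7 HP7-HTW-PROOF.md §3, in set form) [folklore] -/
theorem taAS_section (w w₀ : Sym2 V → ℝ) (x : V) (S : Set V) (v o x₀ v' : V) (X : Set V) (hx₀ : x₀ ∈ X)
    (he0 : w₀ s(x₀, v') = 0) (hoff : ∀ f, f ≠ s(x₀, v') → w₀ f = w f) (g : Set (Sym2 V) → ℝ) :
    taAS w x S v o X g =
      (1 - w s(x₀, v')) * taAS w₀ x S v o X g + w s(x₀, v') * taAS w₀ x S v o (insert v' X) g := by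
  have key := section_generic w w₀ x x₀ v' X hx₀ he0 hoff
    (fun w' B => delE w' B (ind ((connS S v : Set (Set (Sym2 V)))ᶜ ∩ openConn v o)) /
        delE w' B (ind (connS S v : Set (Set (Sym2 V)))ᶜ) *
      (delE w' B (fun η => g (openEdgeCluster η x) * ind (connS S v) η) -
        delE w' B (fun η => g (openEdgeCluster η x)) * delE w' B (ind (connS S v))))
    (fun w w' B h => by simp only [delE_congr_of_mem h])
  simpa only [taAS, taCS, taNS, taNWS] using key

/-- **Section identity for `a` (owner set)**. (cell memo prim-hp-7 HP7-HTW-PROOF.md §3, in set form) [folklore] -/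
theorem taaS_section (w w₀ : Sym2 V → ℝ) (S : Set V) (v o x₀ v' : V) (X : Set V) (hx₀ : x₀ ∈ X)
    (he0 : w₀ s(x₀, v') = 0) (hoff : ∀ f, f ≠ s(x₀, v') → w₀ f = w f) :
    taaS w S v o X = (1 - w s(x₀, v')) * taaS w₀ S v o X + w s(x₀, v') * taaS w₀ S v o (insert v' X) := by
  have key := avoid_conn_section w w₀ v o x₀ v' (S ∪ X) (Set.mem_union_right _ hx₀) he0 hoff
  rw [show insert v' (S ∪ X) = S ∪ insert v' X from by rw [Set.union_insert]] at key
  simpa only [taaS] using key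

/-- **Section identity for `b` (owner set)**. (cell memo prim-hp-7 HP7-HTW-PROOF.md §3, in set form) [folklore] -/
theorem tabS_section (w w₀ : Sym2 V → ℝ) (S : Set V) (v x₀ v' : V) (X : Set V) (hx₀ : x₀ ∈ X)
    (he0 : w₀ s(x₀, v') = 0) (hoff : ∀ f, f ≠ s(x₀, v') → w₀ f = w f) :
    tabS w S v X = (1 - w s(x₀, v')) * tabS w₀ S v X + w s(x₀, v') * tabS w₀ S v (insert v' X) := by
  have key := avoid_conn_section w w₀ v v x₀ v' (S ∪ X) (Set.mem_union_right _ hx₀) he0 hoff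
  rw [show insert v' (S ∪ X) = S ∪ insert v' X from by rw [Set.union_insert]] at key
  have hvv : ∀ (T : Set V) (ω : Set (Sym2 V)), ind (avoidEv v T ∩ openConn v v) ω = ind (avoidEv v T) ω := by
    intro T ω
    have : avoidEv v T ∩ openConn v v = avoidEv v T := by
      ext ω'; simp only [Set.mem_inter_iff, openConn, Set.mem_setOf_eq, and_iff_left_iff_imp]
      exact fun _ => SimpleGraph.Reachable.refl _
    rw [this]
  simp only [hvv] at key
  simpa only [tabS] using key



/-! ### Lemma 2 for the owner set -/

omit [Fintype V] in
/-- `{v ↮ S ∪ (X ∪ {v′})} = {v ↮ S ∪ X} ∖ {v ↔ v′}`. [folklore] -/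
theorem avoidEv_union_insert_eq (S : Set V) (v v' : V) (X : Set V) :
    avoidEv v (S ∪ insert v' X) = avoidEv v (S ∪ X) ∩ (openConn v v' : Set (BondConfig V))ᶜ := by
  ext ω
  simp only [avoidEv, Set.mem_setOf_eq, Set.mem_union, Set.mem_insert_iff, Set.mem_inter_iff, Set.mem_compl_iff,
    openConn]
  constructor
  · intro h
    exact ⟨fun t ht => h t (ht.elim Or.inl fun h' => Or.inr (Or.inr h')), fun hv => h v' (Or.inr (Or.inl rfl)) hv⟩
  · rintro ⟨h1, h2⟩ t ht
    rcases ht with ht | rfl | ht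
    · exact h1 t (Or.inl ht)
    · exact h2
    · exact h1 t (Or.inr ht)

/-- **Lemma 2^S (avoidance monotonicity, owner set)**: `μ(v↔o | v↮S∪X) ≥ μ(v↔o | v↮S∪X∪{v′})`, i.e.
`a₁ b₀ ≤ a₀ b₁` — BHK's Theorem 1.3 for the cluster of `v` given `{v ↮ S ∪ X}` (`1{v↔o}` increasing, `1{v↮v′}` decreasing).
(cell memo prim-hp-7 HP7-HTW-PROOF.md §2) [cite: VandenbergHaggstromKahn2005, Thm. 1.3 (p. 6) — corollary] -/
theorem lemma2S_avoidance (p : Sym2 V → unitInterval) (S : Set V) (v o v' : V) (X : Set V) (hvS : v ∉ S) :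
    taaS (fun e => (p e : ℝ)) S v o (insert v' X) * tabS (fun e => (p e : ℝ)) S v X ≤
      taaS (fun e => (p e : ℝ)) S v o X * tabS (fun e => (p e : ℝ)) S v (insert v' X) := by
  classical
  by_cases hvX : v ∈ X
  · -- `v ∈ X`: the masses at the state `X` vanish
    have hvT : v ∈ S ∪ X := Set.mem_union_right _ hvX
    have h0 : tabS (fun e => (p e : ℝ)) S v X = 0 := by
      refine Finset.sum_eq_zero fun ω _ => ?_
      have : ω ∉ avoidEv v (S ∪ X) := fun h =>
        (h : ∀ t ∈ S ∪ X, ¬ (openGraph ω).Reachable v t) v hvT (SimpleGraph.Reachable.refl _)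
      rw [ind_of_not_mem this, mul_zero]
    have h0' : taaS (fun e => (p e : ℝ)) S v o X = 0 := by
      refine Finset.sum_eq_zero fun ω _ => ?_
      have : ω ∉ avoidEv v (S ∪ X) ∩ openConn v o := fun h =>
        (h.1 : ∀ t ∈ S ∪ X, ¬ (openGraph ω).Reachable v t) v hvT (SimpleGraph.Reachable.refl _)
      rw [ind_of_not_mem this, mul_zero]
    rw [h0, h0', mul_zero, zero_mul]
  set T : Set V := S ∪ X with hT
  have hvT : v ∉ T := fun h => h.elim hvS hvX
  set χ : V → Set (Sym2 V) → ℝ := fun u C => if (u = v ∨ ∃ e ∈ C, u ∈ e) then 1 else 0 with hχ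
  have hχmono : ∀ u, Monotone (χ u) := by
    intro u C C' hCC'
    simp only [hχ]
    by_cases h : (u = v ∨ ∃ e ∈ C, u ∈ e)
    · rw [if_pos h, if_pos (h.imp id fun ⟨e, he, hue⟩ => ⟨e, hCC' he, hue⟩)]
    · rw [if_neg h]; split_ifs <;> norm_num
  have hχeq : ∀ (u : V) (ω : BondConfig V), χ u (openEdgeCluster ω v) = ind (openConn v u) ω := by
    intro u ω
    by_cases h : ω ∈ openConn v u
    · rw [ind_of_mem h, hχ]; simp only [if_pos ((reachable_iff_exists_mem_openEdgeCluster ω v u).1 h)]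
    · rw [ind_of_not_mem h, hχ]
      have h' : ¬ (u = v ∨ ∃ e ∈ openEdgeCluster ω v, u ∈ e) := fun hh =>
        h ((reachable_iff_exists_mem_openEdgeCluster ω v u).2 hh)
      simp only [if_neg h']
  have key := BHK2006_clusterConditionalPositiveAssociation_holds.antitone_right V p v T (χ o)
    (fun C => 1 - χ v' C) (hχmono o) (fun C C' h => by have := hχmono v' h; linarith) hvT
  have hD : {ω : BondConfig V | ∀ x ∈ T, ¬ (openGraph ω).Reachable v x} = avoidEv v T := rfl
  rw [hD] at key
  have hset : avoidEv v (S ∪ insert v' X) = avoidEv v T ∩ (openConn v v' : Set (BondConfig V))ᶜ :=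
    avoidEv_union_insert_eq S v v' X
  have e1 : (prodBernoulli p).real (avoidEv v T) = tabS (fun e => (p e : ℝ)) S v X := by
    rw [measureReal_eq_sum]; rfl
  have e2 : ∫ ω in avoidEv v T, χ o (openEdgeCluster ω v) * (1 - χ v' (openEdgeCluster ω v)) ∂(prodBernoulli p) =
      taaS (fun e => (p e : ℝ)) S v o (insert v' X) := by
    rw [setIntegral_eq_sum, taaS, hset]
    refine Finset.sum_congr rfl fun ω _ => ?_
    rw [hχeq, hχeq, Set.inter_right_comm, ind_inter_compl, ind_inter]
    ring
  have e3 : ∫ ω in avoidEv v T, χ o (openEdgeCluster ω v) ∂(prodBernoulli p) =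
      taaS (fun e => (p e : ℝ)) S v o X := by
    rw [setIntegral_eq_sum, taaS]
    refine Finset.sum_congr rfl fun ω _ => ?_
    rw [hχeq, ind_inter]
    ring
  have e4 : ∫ ω in avoidEv v T, (1 - χ v' (openEdgeCluster ω v)) ∂(prodBernoulli p) =
      tabS (fun e => (p e : ℝ)) S v (insert v' X) := by
    rw [setIntegral_eq_sum, tabS, hset]
    refine Finset.sum_congr rfl fun ω _ => ?_
    rw [hχeq, ind_inter_compl]
    ring
  rw [e1, e2, e3, e4] at key
  linarith


/-! ### Reading the functionals in the deleted configuration; step (II) -/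

/-- The functionals at `X ∪ {v′}` read in the configuration with `cut_X` deleted: `c` (owner set). [folklore] -/
theorem taCS_insert_eq (w wB : Sym2 V → ℝ) (x : V) (S : Set V) (v v' : V) (X : Set V) (g : Set (Sym2 V) → ℝ)
    (ω : Set (Sym2 V)) (hB : ∀ e ∈ cut X ω, wB e = 0) (hoff : ∀ e ∉ cut X ω, wB e = w e) :
    taCS w x S v (insert v' X) g ω = taCS wB x S v {v'} g (ω \ cut X ω) := by
  simp only [taCS, cut_insert_vertex X v' ω, delE_union w wB _ _ hB hoff]

/-- Same for `taNS`. [folklore] -/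
theorem taNS_insert_eq (w wB : Sym2 V → ℝ) (S : Set V) (v v' : V) (X : Set V) (ω : Set (Sym2 V))
    (hB : ∀ e ∈ cut X ω, wB e = 0) (hoff : ∀ e ∉ cut X ω, wB e = w e) :
    taNS w S v (insert v' X) ω = taNS wB S v {v'} (ω \ cut X ω) := by
  simp only [taNS, cut_insert_vertex X v' ω, delE_union w wB _ _ hB hoff]

/-- The functionals at `X` read in the configuration with `cut_X` deleted (empty avoided set): `c` (owner set). [folklore] -/
theorem taCS_eq_empty (w wB : Sym2 V → ℝ) (x : V) (S : Set V) (v : V) (X : Set V) (g : Set (Sym2 V) → ℝ)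
    (ω ζ : Set (Sym2 V)) (hB : ∀ e ∈ cut X ω, wB e = 0) (hoff : ∀ e ∉ cut X ω, wB e = w e) :
    taCS w x S v X g ω = taCS wB x S v ∅ g ζ := by
  simp only [taCS, cut_empty, delE_eq_delE_empty w wB _ hB hoff]

/-- Same for `taNS`. [folklore] -/
theorem taNS_eq_empty (w wB : Sym2 V → ℝ) (S : Set V) (v : V) (X : Set V) (ω ζ : Set (Sym2 V))
    (hB : ∀ e ∈ cut X ω, wB e = 0) (hoff : ∀ e ∉ cut X ω, wB e = w e) :
    taNS w S v X ω = taNS wB S v ∅ ζ := by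
  simp only [taNS, cut_empty, delE_eq_delE_empty w wB _ hB hoff]

/-- Same for `taNWS`. [folklore] -/
theorem taNWS_eq_empty (w wB : Sym2 V → ℝ) (S : Set V) (v o : V) (X : Set V) (ω ζ : Set (Sym2 V))
    (hB : ∀ e ∈ cut X ω, wB e = 0) (hoff : ∀ e ∉ cut X ω, wB e = w e) :
    taNWS w S v o X ω = taNWS wB S v o ∅ ζ := by
  simp only [taNWS, cut_empty, delE_eq_delE_empty w wB _ hB hoff]

/-- **Step (II) for the owner set** (cell memo prim-hp-7 HP7-HTW-PROOF.md §4): `B_{X ∪ {v′}} ≤ B_X − A^{(v′)}_X`, i.e.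
`Σ_ω w 1{x↮X,v′} c_{X∪v′} ≤ Σ_ω w 1{x↮X} c_X · μ_{G−cut_X}(v ↮ v′ | v ↮ S)`, given the within-bound (★^H) of prim-hp-8's
PROOF-S5-ALL-R (K7) at the singleton source `{v′}` (hypothesis `hStarH`, "exploring the cluster of `v′` explains at most the
fraction `μ(v ↮ v′ | v ↮ S)` of `Cov(g(C_x), 1{v ↔ S})`") in every graph with deleted pairs: apply it in `G − cut_X(ω)` for each
`ω` and recombine with `set_sum_cond_sdiff`.
[cite: VandenbergHaggstromKahn2005, §2.1 Lemma 2.4 (p. 10) — corollary; the within-bound is prim-hp-8's (K7), cell memo] -/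
theorem taBS_insert_le (w : Sym2 V → unitInterval) (hw : ∀ e, (w e : ℝ) < 1) (x : V) (S : Set V) (v v' : V) (X : Set V)
    (g : Set (Sym2 V) → ℝ)
    (hStarH : ∀ (q : Sym2 V → unitInterval), (∀ e, (q e : ℝ) < 1) → ∀ u : V,
      taBS (fun e => (q e : ℝ)) x S v {u} g ≤
        (1 - delE (fun e => (q e : ℝ)) ∅ (ind ((connS S v : Set (Set (Sym2 V)))ᶜ ∩ openConn v u)) /
              delE (fun e => (q e : ℝ)) ∅ (ind (connS S v : Set (Set (Sym2 V)))ᶜ)) *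
          (delE (fun e => (q e : ℝ)) ∅ (fun η => g (openEdgeCluster η x) * ind (connS S v) η) -
            delE (fun e => (q e : ℝ)) ∅ (fun η => g (openEdgeCluster η x)) *
              delE (fun e => (q e : ℝ)) ∅ (ind (connS S v)))) :
    taBS (fun e => (w e : ℝ)) x S v (insert v' X) g ≤
      taBS (fun e => (w e : ℝ)) x S v X g - taAS (fun e => (w e : ℝ)) x S v v' X g := by
  classical
  set ŵ : Sym2 V → ℝ := fun e => (w e : ℝ) with hŵ
  have hw0 : ∀ e, 0 ≤ ŵ e := fun e => (w e).2.1
  have hw1 : ∀ e, ŵ e ≤ 1 := fun e => (w e).2.2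
  have hm : ∑ ω, weight ŵ ω = 1 := by
    have h1 := integral_prodBernoulli_eq_sum w fun _ => (1 : ℝ)
    simp only [integral_const, probReal_univ, smul_eq_mul, mul_one] at h1
    exact h1.symm
  set qB : Set (Sym2 V) → Sym2 V → unitInterval := fun W e => if e ∈ barOf X W then 0 else w e with hqB
  set wB : Set (Sym2 V) → Sym2 V → ℝ := fun W e => (qB W e : ℝ) with hwB
  have hB : ∀ (ω : Set (Sym2 V)), ∀ e ∈ cut X ω, wB (setCl ω X) e = 0 := by
    intro ω e he
    rw [cut_eq_barOf] at he
    simp only [hwB, hqB, if_pos he]; rfl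
  have hoff : ∀ (ω : Set (Sym2 V)), ∀ e ∉ cut X ω, wB (setCl ω X) e = ŵ e := by
    intro ω e he
    rw [cut_eq_barOf] at he
    simp only [hwB, hqB, if_neg he, hŵ]
  have hqlt : ∀ (W : Set (Sym2 V)) (e : Sym2 V), (qB W e : ℝ) < 1 := by
    intro W e
    simp only [hqB]
    split_ifs
    · norm_num
    · exact hw e
  set KK : Set (Sym2 V) → Set (Sym2 V) → ℝ := fun W ζ =>
    (if (x ∈ X ∨ ∃ e ∈ W, x ∈ e) then 0 else 1) *
      (ind (avoidEv x {v'}) ζ * taCS (wB W) x S v {v'} g ζ) with hKK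
  have lhs : taBS ŵ x S v (insert v' X) g = ∑ ω, weight ŵ ω * KK (setCl ω X) (ω \ barOf X (setCl ω X)) := by
    refine Finset.sum_congr rfl fun ω _ => ?_
    simp only [hKK]
    rw [← ind_avoidEv_eq_ite, ← cut_eq_barOf]
    by_cases hω : ω ∈ avoidEv x X
    · have h1 : ind (avoidEv x (insert v' X)) ω = ind (avoidEv x X) ω * ind (avoidEv x {v'}) (ω \ cut X ω) := by
        rw [ind_of_mem hω, one_mul]
        by_cases h' : ω ∈ avoidEv x (insert v' X)
        · rw [ind_of_mem h', ind_of_mem ((mem_avoidEv_insert_iff x v' X ω hω).1 h')]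
        · rw [ind_of_not_mem h', ind_of_not_mem fun hh => h' ((mem_avoidEv_insert_iff x v' X ω hω).2 hh)]
      rw [h1, taCS_insert_eq ŵ (wB (setCl ω X)) x S v v' X g ω (hB ω) (hoff ω)]
      ring
    · have h' : ω ∉ avoidEv x (insert v' X) := fun hh => hω fun t ht => hh t (Set.mem_insert_of_mem _ ht)
      rw [ind_of_not_mem h', ind_of_not_mem hω]; ring
  rw [lhs, set_sum_cond_sdiff ŵ hm X KK]
  have rhs : taBS ŵ x S v X g - taAS ŵ x S v v' X g =
      ∑ ω, weight ŵ ω * (ind (avoidEv x X) ω *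
        ((1 - taNWS ŵ S v v' X ω / taNS ŵ S v X ω) * taCS ŵ x S v X g ω)) := by
    simp only [taBS, taAS, ← Finset.sum_sub_distrib]
    refine Finset.sum_congr rfl fun ω _ => ?_
    ring
  rw [rhs]
  refine Finset.sum_le_sum fun ω _ => mul_le_mul_of_nonneg_left ?_ (weight_nonneg hw0 hw1 ω)
  simp only [hKK]
  rw [← ind_avoidEv_eq_ite]
  by_cases hω : ω ∈ avoidEv x X
  swap
  · rw [ind_of_not_mem hω]; simp
  rw [ind_of_mem hω, one_mul]
  have inner : ∑ η, weight ŵ η * (1 * (ind (avoidEv x {v'}) (η \ barOf X (setCl ω X)) *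
      taCS (wB (setCl ω X)) x S v {v'} g (η \ barOf X (setCl ω X)))) = taBS (wB (setCl ω X)) x S v {v'} g := by
    simp only [one_mul, taBS]
    rw [← cut_eq_barOf]
    rw [sum_weight_mul_comp_sdiff ŵ (cut X ω)
      (fun ζ => ind (avoidEv x {v'}) ζ * taCS (wB (setCl ω X)) x S v {v'} g ζ)]
    refine Finset.sum_congr rfl fun η _ => ?_
    congr 2
    funext e
    by_cases he : e ∈ cut X ω
    · rw [if_pos he, hB ω e he]
    · rw [if_neg he, hoff ω e he]
  rw [inner]
  have e1 := taCS_eq_empty ŵ (wB (setCl ω X)) x S v X g ω ∅ (hB ω) (hoff ω)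
  have e2 := taNS_eq_empty ŵ (wB (setCl ω X)) S v X ω ∅ (hB ω) (hoff ω)
  have e3 := taNWS_eq_empty ŵ (wB (setCl ω X)) S v v' X ω ∅ (hB ω) (hoff ω)
  rw [e1, e2, e3]
  have key := hStarH (qB (setCl ω X)) (hqlt (setCl ω X)) v'
  simp only [taCS, taNS, taNWS, cut_empty] at key ⊢
  exact key


end TAS

end HullPort

end Summit.CriticalPhenomena.PercolationContinuityZ3.Theorems
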